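import Summits.ValiantsHypothesis.ValiantsHypothesis.Theorems.GrenetZeonDualUnipotentThreeHalvesLongMassPerPencilPrice
import Summits.ValiantsHypothesis.ValiantsHypothesis.Theorems.GrenetZeonDualUnipotentThreeHalvesLongMassGauge

/-!
# Crux `GrenetZeon.TwoDimCoefficients` (stmt-ValiantsHypothesis-8062), stub `stub_dualUnipotent` / rung `DualUnipotentThreeHalves`
# (stmt-24318): RUNGS BY NAME THROUGH THE PRICE BRIDGE — every (c)-row `RelCert n m N ρ` is the exclusion `n(n−1) ≤ ρ`

✓ `…LongMassPerPencilPrice` (this seat, p842957) proved that a pencil `N` with `per_n = tr(N^{n−1}·M)` (`M` affine) is never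
`SlowCore.Slow`, so that EVERY whole-pencil certificate of it costs `≥ n(n−1)` (`PerPencilPrice.le_of_relCert_of_perPoly_eq_trace`).
Feeding the ROWS of the (c)-price calculus of line `slow_core` (24318) into that floor turns each of them into a rung / an exclusion
for the trace-power (unipotent-dual) representations of the permanent, with no flatness or Hessian argument on the 8062 side:

* §1 ABSORB row (✓ `Ceilings.relCert_absorb_of_pow_eq_zero`, price `n(H−1)`) ⟹ `le_index_of_perPoly_eq_trace`: an affine pencil with
  `N^H = 0` representing `per_n` (`n ≥ 2`) has `H ≥ n` (the polynomial nil-index is at least `n`; by name).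
* §2 ★★ TRIANGULARISABLE row at EVERY block height (✓ `TriangularRow.relCert_of_triangularisable`, price `n·⌊(m−1)/h⌋ + ⌊m(h−1)/2⌋`)
  ⟹ `triangular_rung` / `triangular_rung_closed`: if ONE constant unit conjugates the affine pencil `N` into the strictly upper triangular
  matrices, then for every `h ≥ 1`
      `2h·n(n−1) ≤ 2n(m−1) + m·h(h−1)`,
  i.e. (at `h ≈ √(2n)`) **`m ≳ n^{3/2}/√2`** — TWICE the constant of the tree's triangularisable rung ✓ `sq_le_of_trace_pow_mul_strictUpper'` /
  ✓ `sq_le_of_trace_pow_mul_triangularisable` (`q·n² ≤ 2n(m+q) + m·q²`, `m ≳ n^{3/2}/(2√2)`): GMS (`dim K ≤ k·n`) replaces LEMMA_k (`≤ 2kn`),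
  and only the `C(h,2)` strictly-upper entries of each diagonal block are frozen (`m(h−1)/2` instead of `m·q`).
  Value-space forms `rung_of_valueSpace_triangularisable`, and — via the tree's Engel / McCoy / word criteria
  ✓ `NilSpaceEngel.exists_unit_conj_strictUpper_of_lieClosed / _of_mulClosed / _of_commute / _of_words_eq_zero` —
  ★ `rung_of_valueSpace_lieClosed`, `rung_of_valueSpace_mulClosed`, `rung_of_valueSpace_commute`, `rung_of_valueSpace_words_eq_zero`
  (the 27th hand's ✓ `…DualUnipotentEngelRung` at the doubled constant, each in one line).
* §3 GAUGE row (✓ `GaugeRow.relCert_gaugePencil`, price `2n+1` at EVERY width `m ≥ 2`) ⟹ ★ `not_perPoly_eq_trace_gaugePencil`: for `n ≥ 4`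
  NO gauge pencil `ℓ•J + [Ĉ,J]` (affine form `ℓ`, affine hook-supported `Ĉ`) represents `per_n` as `tr(N^{n−1}·M)`, whatever `m` and `M` —
  the first exclusion of a named IRREDUCIBLE-type species on the 8062 side that is not a triangularisability statement.
* §4 RANK row (Flanders–Meshulam, ✓ `NilSpaceRankCeiling.exists_rank_mul_gt_of_expensive`) ⟹ `exists_rank_mul_ge_of_perPoly_eq_trace`: the value
  space of a linear `per_n`-representing pencil (`n ≥ 2`) contains a matrix `A` with `rank A · m ≥ n(n−1)` (generic rank `≳ n²/m`).
* §5 in the stub's currency `DualUnipotentRepr n m`: `rank_rung_of_dualUnipotentRepr`.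

HONEST FRAMING.  Rungs/exclusions on SUB-CASES (triangularisable, Engel, word-nil, gauge, bounded rank) obtained by name from landed rows;
`--supports stmt-ValiantsHypothesis-8062 --as helper`.  The located open point (WILD value spaces: a non-vanishing word of length `m`, no
gauge structure) is untouched: `stub_dualUnipotent : DualUnipotentBound`, the crux `TwoDimCoefficients` (aside), the rung 24318, (c)
`SlowCore.LongMassSlowLawInv` and `VP ≠ VNP` are NOT proved.  Def-free, no named-fact hypotheses, no sorry.

References: A. Guterman, R. Meshulam, I. Spiridonov (2023), Cor. 1.6 [tree: `…_cor_1_6_holds`]; R. Meshulam, Linear Algebra Appl. 71 (1985), Thm. 2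
[tree: `Literature.LinearAlgebra.Meshulam1985_exists_rank_gt_holds`]; Horn–Johnson (2013) §2.4.8 [tree McCoy / Engel rows].
-/

-- single-conjunct layout: Sub = Summit, duplicated namespace component intended (the name is mandated)
set_option linter.dupNamespace false
set_option autoImplicit false

noncomputable section

namespace Summit.ValiantsHypothesis.ValiantsHypothesis.Theorems.GrenetZeon.PerPencilPrice

open MvPolynomial Matrix
open scoped BigOperators
open Literature.Computability.AlgebraicComplexity (perPoly)
open Summit.ValiantsHypothesis.ValiantsHypothesis.Cruxes.TwoDimCoefficients.DimTwoCases
  (AffMat IsAffine DualUnipotentRepr exists_nilpotent_pencil_of_dualUnipotentRepr)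
open Summit.ValiantsHypothesis.ValiantsHypothesis.Theorems.GrenetZeon.SlowCore
open Summit.ValiantsHypothesis.ValiantsHypothesis.Theorems.GrenetZeon.Ceilings (relCert_absorb_of_pow_eq_zero)
open Summit.ValiantsHypothesis.ValiantsHypothesis.Theorems.GrenetZeon.TriangularRow (relCert_of_triangularisable)
open Summit.ValiantsHypothesis.ValiantsHypothesis.Theorems.GrenetZeon.NilSpaceEngel
  (exists_unit_conj_strictUpper_of_lieClosed exists_unit_conj_strictUpper_of_mulClosed exists_unit_conj_strictUpper_of_commute
    exists_unit_conj_strictUpper_of_words_eq_zero)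
open Summit.ValiantsHypothesis.ValiantsHypothesis.Theorems.GrenetZeon.GaugeRow (gaugePencil HookSupp relCert_gaugePencil isAffine_gaugePencil)
open Summit.ValiantsHypothesis.ValiantsHypothesis.Theorems.GrenetZeon.ResolventFlag (linMat)
open Summit.ValiantsHypothesis.ValiantsHypothesis.Theorems.GrenetZeon.LedgerIndex (exists_linearMap_linMat)
open Summit.ValiantsHypothesis.ValiantsHypothesis.Theorems.GrenetZeon.NilSpaceRankCeiling (exists_rank_mul_gt_of_expensive)

variable {n m : ℕ}

/-! ## §1 The absorb row: the nil-index of a `per_n`-representing affine pencil is at least `n` -/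

/-- **INDEX ≥ n.**  If an AFFINE pencil with `N^H = 0` represents `per_n = tr(N^{n−1}·M)` (`M` affine, `n ≥ 2`), then `n ≤ H`
(absorb row ✓ `Ceilings.relCert_absorb_of_pow_eq_zero`, price `n(H−1)`, against the floor `n(n−1)`). [this file] -/
theorem le_index_of_perPoly_eq_trace (hn : 2 ≤ n) (N M : AffMat n m) (hN : IsAffine N) (hM : IsAffine M)
    (hper : perPoly (Fin n) ℂ = (N ^ (n - 1) * M).trace) {H : ℕ} (hH : N ^ H = 0) : n ≤ H := by
  have h := le_of_relCert_of_perPoly_eq_trace N M hM hper (relCert_absorb_of_pow_eq_zero N hN hH)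
  have h' : n - 1 ≤ H - 1 := Nat.le_of_mul_le_mul_left h (by omega)
  omega

/-! ## §2 The triangularisable row at every block height: `m ≳ n^{3/2}/√2` -/

/-- ★★ **TRIANGULAR RUNG (floor form).**  An affine pencil conjugated by ONE constant unit into the strictly upper triangular matrices and
representing `per_n = tr(N^{n−1}·M)` (`M` affine) satisfies, for every block height `h ≥ 1`,
`n(n−1) ≤ n·⌊(m−1)/h⌋ + ⌊m(h−1)/2⌋` (✓ `TriangularRow.relCert_of_triangularisable` against the floor). [this file] -/
theorem triangular_rung (N M : AffMat n m) (hN : IsAffine N) (hM : IsAffine M)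
    (hper : perPoly (Fin n) ℂ = (N ^ (n - 1) * M).trace)
    (P : (Matrix (Fin m) (Fin m) ℂ)ˣ)
    (htri : ∀ i j : Fin m, j ≤ i →
      ((P : Matrix (Fin m) (Fin m) ℂ).map C * N * (↑P⁻¹ : Matrix (Fin m) (Fin m) ℂ).map C : AffMat n m) i j = 0)
    (h : ℕ) (hh : 1 ≤ h) :
    n * (n - 1) ≤ n * ((m - 1) / h) + m * (h - 1) / 2 :=
  le_of_relCert_of_perPoly_eq_trace N M hM hper (relCert_of_triangularisable N hN P htri h hh)

/-- ★★ **TRIANGULAR RUNG (closed form).**  Same hypotheses: for every `h ≥ 1`, `2h·n(n−1) ≤ 2n(m−1) + m·h(h−1)`.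
At `h ≈ √(2n)` this is `m ≳ n^{3/2}/√2`, twice the constant of ✓ `sq_le_of_trace_pow_mul_strictUpper'`. [this file] -/
theorem triangular_rung_closed (N M : AffMat n m) (hN : IsAffine N) (hM : IsAffine M)
    (hper : perPoly (Fin n) ℂ = (N ^ (n - 1) * M).trace)
    (P : (Matrix (Fin m) (Fin m) ℂ)ˣ)
    (htri : ∀ i j : Fin m, j ≤ i →
      ((P : Matrix (Fin m) (Fin m) ℂ).map C * N * (↑P⁻¹ : Matrix (Fin m) (Fin m) ℂ).map C : AffMat n m) i j = 0)
    (h : ℕ) (hh : 1 ≤ h) :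
    2 * h * (n * (n - 1)) ≤ 2 * n * (m - 1) + m * (h * (h - 1)) := by
  have h1 := triangular_rung N M hN hM hper P htri h hh
  set a := (m - 1) / h with ha_def
  set b := m * (h - 1) / 2 with hb_def
  have ha : h * a ≤ m - 1 := by rw [mul_comm]; exact Nat.div_mul_le_self (m - 1) h
  have hb : 2 * b ≤ m * (h - 1) := by rw [mul_comm]; exact Nat.div_mul_le_self _ 2
  calc 2 * h * (n * (n - 1)) ≤ 2 * h * (n * a + b) := Nat.mul_le_mul_left _ h1
    _ = 2 * n * (h * a) + h * (2 * b) := by ring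
    _ ≤ 2 * n * (m - 1) + h * (m * (h - 1)) := add_le_add (Nat.mul_le_mul_left _ ha) (Nat.mul_le_mul_left _ hb)
    _ = 2 * n * (m - 1) + m * (h * (h - 1)) := by ring

/-- From a unit conjugating the VALUE SPACE into the strictly upper triangular matrices to the pencil-level hypothesis
(polynomial identity by ✓ `MvPolynomial.funext`; the computation of ✓ `TriangularRow.relCert_of_valueSpace_triangularisable_two`). -/
theorem conj_strictUpper_pencil_of_valueSpace (N : AffMat n m)
    (V : Submodule ℂ (Matrix (Fin m) (Fin m) ℂ)) (hV : ∀ x : Fin n × Fin n → ℂ, N.map (MvPolynomial.eval x) ∈ V)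
    (P : (Matrix (Fin m) (Fin m) ℂ)ˣ)
    (hP : ∀ A ∈ V, ∀ i j : Fin m, j ≤ i →
      ((P : Matrix (Fin m) (Fin m) ℂ) * A * (↑P⁻¹ : Matrix (Fin m) (Fin m) ℂ)) i j = 0) :
    ∀ i j : Fin m, j ≤ i →
      ((P : Matrix (Fin m) (Fin m) ℂ).map C * N * (↑P⁻¹ : Matrix (Fin m) (Fin m) ℂ).map C : AffMat n m) i j = 0 := by
  intro i j hji
  apply MvPolynomial.funext
  intro x
  have h1 : MvPolynomial.eval x (((P : Matrix (Fin m) (Fin m) ℂ).map C * N *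
      (↑P⁻¹ : Matrix (Fin m) (Fin m) ℂ).map C : AffMat n m) i j) =
      ((P : Matrix (Fin m) (Fin m) ℂ) * N.map (MvPolynomial.eval x) * (↑P⁻¹ : Matrix (Fin m) (Fin m) ℂ)) i j := by
    have hPC : ((P : Matrix (Fin m) (Fin m) ℂ).map C).map (MvPolynomial.eval x) = (P : Matrix (Fin m) (Fin m) ℂ) := by
      rw [Matrix.map_map]; ext a c; simp
    have hQC : ((↑P⁻¹ : Matrix (Fin m) (Fin m) ℂ).map C).map (MvPolynomial.eval x) = (↑P⁻¹ : Matrix (Fin m) (Fin m) ℂ) := by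
      rw [Matrix.map_map]; ext a c; simp
    rw [← Matrix.map_apply (f := MvPolynomial.eval x), Matrix.map_mul, Matrix.map_mul, hPC, hQC]
  rw [h1, map_zero]
  exact hP _ (hV x) i j hji

/-- ★ **Value-space form.**  If all values `N(x)` lie in a space `V` that ONE unit conjugates into the strictly upper triangular matrices,
then `2h·n(n−1) ≤ 2n(m−1) + m·h(h−1)` for every `h ≥ 1`. [this file] -/
theorem rung_of_valueSpace_triangularisable (N M : AffMat n m) (hN : IsAffine N) (hM : IsAffine M)
    (hper : perPoly (Fin n) ℂ = (N ^ (n - 1) * M).trace)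
    (V : Submodule ℂ (Matrix (Fin m) (Fin m) ℂ)) (hV : ∀ x : Fin n × Fin n → ℂ, N.map (MvPolynomial.eval x) ∈ V)
    (P : (Matrix (Fin m) (Fin m) ℂ)ˣ)
    (hP : ∀ A ∈ V, ∀ i j : Fin m, j ≤ i →
      ((P : Matrix (Fin m) (Fin m) ℂ) * A * (↑P⁻¹ : Matrix (Fin m) (Fin m) ℂ)) i j = 0)
    (h : ℕ) (hh : 1 ≤ h) :
    2 * h * (n * (n - 1)) ≤ 2 * n * (m - 1) + m * (h * (h - 1)) :=
  triangular_rung_closed N M hN hM hper P (conj_strictUpper_pencil_of_valueSpace N V hV P hP) h hh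

/-- ★ **ENGEL RUNG** (values in a Lie-closed space of nilpotent matrices; Mathlib Engel + tree McCoy via
✓ `NilSpaceEngel.exists_unit_conj_strictUpper_of_lieClosed`): `2h·n(n−1) ≤ 2n(m−1) + m·h(h−1)` for every `h ≥ 1`. [this file] -/
theorem rung_of_valueSpace_lieClosed (N M : AffMat n m) (hN : IsAffine N) (hM : IsAffine M)
    (hper : perPoly (Fin n) ℂ = (N ^ (n - 1) * M).trace)
    (V : Submodule ℂ (Matrix (Fin m) (Fin m) ℂ)) (hV : ∀ x : Fin n × Fin n → ℂ, N.map (MvPolynomial.eval x) ∈ V)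
    (hnil : ∀ A ∈ V, IsNilpotent A) (hlie : ∀ A ∈ V, ∀ B ∈ V, A * B - B * A ∈ V) (h : ℕ) (hh : 1 ≤ h) :
    2 * h * (n * (n - 1)) ≤ 2 * n * (m - 1) + m * (h * (h - 1)) := by
  obtain ⟨P, hP⟩ := exists_unit_conj_strictUpper_of_lieClosed V hnil hlie
  exact rung_of_valueSpace_triangularisable N M hN hM hper V hV P hP h hh

/-- **NIL-ALGEBRA RUNG** (values in a multiplicatively closed space of nilpotent matrices). [this file] -/
theorem rung_of_valueSpace_mulClosed (N M : AffMat n m) (hN : IsAffine N) (hM : IsAffine M)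
    (hper : perPoly (Fin n) ℂ = (N ^ (n - 1) * M).trace)
    (V : Submodule ℂ (Matrix (Fin m) (Fin m) ℂ)) (hV : ∀ x : Fin n × Fin n → ℂ, N.map (MvPolynomial.eval x) ∈ V)
    (hnil : ∀ A ∈ V, IsNilpotent A) (hmul : ∀ A ∈ V, ∀ B ∈ V, A * B ∈ V) (h : ℕ) (hh : 1 ≤ h) :
    2 * h * (n * (n - 1)) ≤ 2 * n * (m - 1) + m * (h * (h - 1)) := by
  obtain ⟨P, hP⟩ := exists_unit_conj_strictUpper_of_mulClosed V hnil hmul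
  exact rung_of_valueSpace_triangularisable N M hN hM hper V hV P hP h hh

/-- **COMMUTATIVE RUNG** (values in a commutative space of nilpotent matrices). [this file] -/
theorem rung_of_valueSpace_commute (N M : AffMat n m) (hN : IsAffine N) (hM : IsAffine M)
    (hper : perPoly (Fin n) ℂ = (N ^ (n - 1) * M).trace)
    (V : Submodule ℂ (Matrix (Fin m) (Fin m) ℂ)) (hV : ∀ x : Fin n × Fin n → ℂ, N.map (MvPolynomial.eval x) ∈ V)
    (hnil : ∀ A ∈ V, IsNilpotent A) (hcomm : ∀ A ∈ V, ∀ B ∈ V, A * B = B * A) (h : ℕ) (hh : 1 ≤ h) :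
    2 * h * (n * (n - 1)) ≤ 2 * n * (m - 1) + m * (h * (h - 1)) := by
  obtain ⟨P, hP⟩ := exists_unit_conj_strictUpper_of_commute V hnil hcomm
  exact rung_of_valueSpace_triangularisable N M hN hM hper V hV P hP h hh

/-- ★ **WORD RUNG** (all `V`-words of some length `s` vanish — the intrinsic form of triangularisability,
✓ `NilSpaceEngel.exists_unit_conj_strictUpper_of_words_eq_zero`). [this file] -/
theorem rung_of_valueSpace_words_eq_zero (N M : AffMat n m) (hN : IsAffine N) (hM : IsAffine M)
    (hper : perPoly (Fin n) ℂ = (N ^ (n - 1) * M).trace)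
    (V : Submodule ℂ (Matrix (Fin m) (Fin m) ℂ)) (hV : ∀ x : Fin n × Fin n → ℂ, N.map (MvPolynomial.eval x) ∈ V) {s : ℕ}
    (hwords : ∀ w : Fin s → Matrix (Fin m) (Fin m) ℂ, (∀ t, w t ∈ V) → (List.ofFn w).prod = 0) (h : ℕ) (hh : 1 ≤ h) :
    2 * h * (n * (n - 1)) ≤ 2 * n * (m - 1) + m * (h * (h - 1)) := by
  obtain ⟨P, hP⟩ := exists_unit_conj_strictUpper_of_words_eq_zero V hwords
  exact rung_of_valueSpace_triangularisable N M hN hM hper V hV P hP h hh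

/-! ## §3 The gauge row: gauge pencils never represent `per_n` (`n ≥ 4`) -/

/-- ★ **NO GAUGE PENCIL REPRESENTS THE PERMANENT.**  For `n ≥ 4`, an affine form `ℓ`, an affine hook-supported `Ĉ` and ANY affine `M`
(any width `m`): `per_n ≠ tr((ℓ•J + [Ĉ,J])^{n−1}·M)` — the gauge row ✓ `GaugeRow.relCert_gaugePencil` prices these pencils at `2n + 1 < n(n−1)`.
[this file] -/
theorem not_perPoly_eq_trace_gaugePencil (hn : 4 ≤ n) {ℓ : MvPolynomial (Fin n × Fin n) ℂ} {Ĉ : AffMat n m}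
    (hℓ : ℓ.totalDegree ≤ 1) (hĈa : IsAffine Ĉ) (hĈ : HookSupp Ĉ) (M : AffMat n m) (hM : IsAffine M) :
    perPoly (Fin n) ℂ ≠ ((gaugePencil ℓ Ĉ) ^ (n - 1) * M).trace := by
  intro hper
  have h := le_of_relCert_of_perPoly_eq_trace (gaugePencil ℓ Ĉ) M hM hper (relCert_gaugePencil hℓ hĈa hĈ)
  obtain ⟨n', rfl⟩ : ∃ n', n = n' + 4 := ⟨n - 4, by omega⟩
  have : (n' + 4) * (n' + 4 - 1) = n' * n' + 7 * n' + 12 := by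
    rw [show n' + 4 - 1 = n' + 3 by omega]; ring
  rw [this] at h
  nlinarith

/-! ## §4 The rank row: a value of rank `≥ n(n−1)/m` -/

/-- ★ **GENERIC RANK `≳ n²/m`.**  The value space of a LINEAR pencil representing `per_n = tr(N^{n−1}·M)` (`M` affine, `n ≥ 2`) contains a
matrix `A` with `n(n−1) ≤ rank A · m` (rank ceiling ✓ `NilSpaceRankCeiling.exists_rank_mul_gt_of_expensive`, Flanders–Meshulam by name,
against `expensive_valueSpace_of_perPoly_eq_trace`). [cite: Meshulam1985, Thm. 2 (p. 226)] -/
theorem exists_rank_mul_ge_of_perPoly_eq_trace (hn : 2 ≤ n) (N M : AffMat n m) (hN : IsAffine N)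
    (h0 : ∀ i j, coeff 0 (N i j) = 0) (hM : IsAffine M) (hper : perPoly (Fin n) ℂ = (N ^ (n - 1) * M).trace)
    (T : (Fin n × Fin n → ℂ) →ₗ[ℂ] Matrix (Fin m) (Fin m) ℂ) (hT : ∀ v, T v = linMat N v) :
    ∃ A ∈ LinearMap.range T, n * (n - 1) ≤ A.rank * m := by
  have hpos : 0 < n * (n - 1) := Nat.mul_pos (by omega) (by omega)
  have hP : n * (n - 1) - 1 < n * (n - 1) := Nat.sub_lt hpos Nat.one_pos
  obtain ⟨A, hA, hlt⟩ := exists_rank_mul_gt_of_expensive (LinearMap.range T) n _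
    (expensive_valueSpace_of_perPoly_eq_trace N M hN h0 hM hper T hT hP)
  exact ⟨A, hA, by omega⟩

/-! ## §5 In the stub's currency -/

/-- ★ **RANK RUNG for `DualUnipotentRepr`.**  Every unipotent-dual representation of `per_n` of width `m` (`n ≥ 2`) carries a linear nilpotent
pencil one of whose values has `rank · m ≥ n(n−1)`; together with `rank < m` (nilpotent) this re-derives `m(m−1) ≥ n(n−1)`, and for BOUNDED
generic rank `r` it reads `m ≥ n(n−1)/r`. [this file] -/
theorem rank_rung_of_dualUnipotentRepr (hn : 2 ≤ n) (h : DualUnipotentRepr n m) :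
    ∃ (N M : AffMat n m) (T : (Fin n × Fin n → ℂ) →ₗ[ℂ] Matrix (Fin m) (Fin m) ℂ),
      IsAffine N ∧ (∀ i j, coeff 0 (N i j) = 0) ∧ N ^ m = 0 ∧ perPoly (Fin n) ℂ = (N ^ (n - 1) * M).trace ∧
      (∀ v, T v = linMat N v) ∧ ∃ A ∈ LinearMap.range T, n * (n - 1) ≤ A.rank * m := by
  obtain ⟨N, M, hN, hM, hnil, hper⟩ := exists_nilpotent_pencil_of_dualUnipotentRepr (by omega) h
  have hNa := isAffine_of_isHomogeneous_one N hN
  have hMa := isAffine_of_isHomogeneous_one M hM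
  have h0 := coeff_zero_of_isHomogeneous_one N hN
  obtain ⟨T, hT⟩ := exists_linearMap_linMat N
  exact ⟨N, M, T, hNa, h0, hnil, hper, hT, exists_rank_mul_ge_of_perPoly_eq_trace hn N M hNa h0 hMa hper T hT⟩

/-! ## §6 (appended) Small widths excluded by `2n(n−1) ≤ m(m−1)`

(The inequality itself is the tree's ✓ `two_mul_mul_pred_le_of_dualUnipotentRepr` (`…PermanentFlatSharp`, sharp Hessian-flat count, `n ≥ 3`),
re-derived through the price bridge as ✓ `PerPencilPrice.two_mul_le_of_dualUnipotentRepr` (`n ≥ 1`); the cases `per_4 ≥ 6`, `per_5 ≥ 7` are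
✓ `not_dualUnipotentRepr_four_five` / `_five_six` there.) -/

/-- **Width exclusion in closed form.**  `m(m−1) < 2n(n−1)` (`n ≥ 1`) ⟹ no unipotent-dual representation of `per_n` of width `m`
(✓ `two_mul_le_of_dualUnipotentRepr`). [this file] -/
theorem not_dualUnipotentRepr_of_lt (hn : 1 ≤ n) (hlt : m * (m - 1) < 2 * (n * (n - 1))) : ¬ DualUnipotentRepr n m :=
  fun h => absurd (two_mul_le_of_dualUnipotentRepr hn h) (not_le.mpr hlt)

/-- **`per_6` has unipotent-trace width `≥ 9`** (`8·7 = 56 < 60 = 2·6·5`). [this file] -/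
theorem not_dualUnipotentRepr_six_eight : ¬ DualUnipotentRepr 6 8 :=
  not_dualUnipotentRepr_of_lt (n := 6) (m := 8) (by norm_num) (by norm_num)

/-- **`per_7` has unipotent-trace width `≥ 10`** (`9·8 = 72 < 84 = 2·7·6`). [this file] -/
theorem not_dualUnipotentRepr_seven_nine : ¬ DualUnipotentRepr 7 9 :=
  not_dualUnipotentRepr_of_lt (n := 7) (m := 9) (by norm_num) (by norm_num)

end Summit.ValiantsHypothesis.ValiantsHypothesis.Theorems.GrenetZeon.PerPencilPrice

end
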